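import Summits.NavierStokesRegularity.NavierStokesRegularity.Theorems.TypeICertificateLadderTargetStretchingLogMean
import Summits.NavierStokesRegularity.NavierStokesRegularity.Theorems.TypeICertificateLadderTargetStrainCubeLambSplitGalilean
import HarnessLib

/-!
# Crux `Target` = `TypeICertificateLadder.NoTypeIBlowup` (stmt-NavierStokesRegularity-1217), line
# `depletion-ladder`: THE GAUGED LOG-AMPLITUDE RUNG at the split constant — threshold `A < 564 − 144√15 ≈ 6.29`

`--supports stmt-NavierStokesRegularity-1217` (helper). Author: STA lineage `ns-sta-19551-p1` (g11). Lifts the landed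
log-amplitude rung (p543431 `hasSmoothExtensionPast_of_logIntegral_oscillation`, threshold `A < 81(7 − 4√3) ≈ 5.8155`
at `κ = (2+√3)/9`) to the split constant `κ = (9 + 2√15)/42` (p584722 / p585381), through the log-mean stretching law
(p582058 `hasSmoothExtensionPast_of_logMean_stretching`).

* `hasSmoothExtensionPast_of_logIntegral_amplitude_of_depletion` — ABSTRACT form: if from an onset `t₁` a measurable
  amplitude `m` and a constant `κ` majorise the stretching, `|∫⟪ω, Du ω⟫(t)| ≤ κ·m(t)·‖ω(t)‖₂‖∇ω(t)‖₂`
  (`t ∈ [t₁,T)`), with `m²` locally interval integrable and `∫_{t₁}^t m² ≤ ν(A log((T−t₁)/(T−t)) + B)`, `κ²A < 1`,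
  then the classical Leray–Hopf rapidly-decaying-datum solution extends past `T` (`σ = κ m √((T−τ)/ν)` in the law).
* `lambSplit_galilean_along_flow` — along such a flow, for every `t ∈ [0,T)`, every gauge vector `c` and every
  `M ≥ sup_x ‖u(t,x) − c‖`: `|∫⟪ω, Du ω⟫(t)| ≤ ((9+2√15)/42)·M·‖ω(t)‖₂‖∇ω(t)‖₂` (slices are admissible: Tao cover).
* `hasSmoothExtensionPast_of_logIntegral_gaugedAmplitude_lambSplit` — **THE GAUGED LOG-AMPLITUDE RUNG**: any gauge
  `c : ℝ → ℝ³` and amplitude `m(t) ≥ sup_x ‖u(t,x) − c(t)‖` on `[t₁,T)` (`m²` locally interval integrable) with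
  `∫_{t₁}^t m² ≤ ν(A log((T−t₁)/(T−t)) + B)` and `((9+2√15)/42)²·A < 1`, i.e. **`A < (18 − 4√15)² = 564 − 144√15 = 6.2903…`**
  (`lambSplit_amplitude_threshold`), force extension past `T`. The sup-rate rung `C ≤ 2.5` is the case
  `m² = C²ν/(T−t)`, `A = C²`.

WHAT THIS IS NOT: a conditional criterion; nothing on Type II; not the crux. [folklore]
-/

noncomputable section

open Set Filter Topology MeasureTheory
open scoped RealInnerProductSpace ENNReal NNReal ContDiff
open Literature.Analysis.FluidPDE

namespace Summit.NavierStokesRegularity.NavierStokesRegularity.Theorems.DepletionLadder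

-- the problem directory repeats the summit name (`NavierStokesRegularity/NavierStokesRegularity`)
set_option linter.dupNamespace false

open Summit.NavierStokesRegularity.NavierStokesRegularity.Theorems.RungReynoldsOne

/-- **Log-amplitude rung, abstract depletion form.** Along a classical Leray–Hopf rapidly-decaying-datum solution
on `[0,T)`: if `m²` is interval integrable on every `[t₁,t]`,
`|∫⟪ω, Du ω⟫(t)| ≤ κ·m(t)·‖ω(t)‖₂·‖∇ω(t)‖₂` for `t ∈ [t₁,T)`, `∫_{t₁}^t m² ≤ ν(A log((T−t₁)/(T−t)) + B)` for
`t ∈ [t₁,T)` and `κ²A < 1`, then the solution extends smoothly past `T`. [folklore] -/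
theorem hasSmoothExtensionPast_of_logIntegral_amplitude_of_depletion {ν κ T t₁ A B : ℝ} (hν : 0 < ν)
    (hT : 0 < T) (hA : κ ^ 2 * A < 1) (ht₁ : t₁ ∈ Ico 0 T)
    {u : ℝ → EuclideanSpace ℝ (Fin 3) → EuclideanSpace ℝ (Fin 3)}
    {p : ℝ → EuclideanSpace ℝ (Fin 3) → ℝ}
    (hsol : IsClassicalNSSolutionOn (Ico 0 T) ν 0 u p) (hLH : IsLerayHopfOn T ν 0 (u 0) u)
    (hdec : HasRapidSpatialDecay (u 0))
    {m : ℝ → ℝ}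
    (hii : ∀ t ∈ Ico t₁ T, IntervalIntegrable (fun τ => m τ ^ 2) volume t₁ t)
    (hdep : ∀ t ∈ Ico t₁ T, |∫ x, ⟪curl (u t) x, fderiv ℝ (u t) x (curl (u t) x)⟫| ≤
      κ * m t * Real.sqrt (∫ x, ‖curl (u t) x‖ ^ 2) *
        Real.sqrt (∫ x, frobeniusNormSq (fderiv ℝ (curl (u t)) x)))
    (hint : ∀ t ∈ Ico t₁ T, ∫ τ in t₁..t, m τ ^ 2 ≤ ν * (A * Real.log ((T - t₁) / (T - t)) + B)) :
    HasSmoothExtensionPast ν 0 u T := by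
  -- the majorant `σ = κ m √((T−τ)/ν)` of the stretching number
  set σ : ℝ → ℝ := fun τ => κ * m τ * Real.sqrt ((T - τ) / ν) with hσdef
  have hστ : ∀ τ, τ < T → σ τ ^ 2 / (T - τ) = κ ^ 2 * m τ ^ 2 / ν := by
    intro τ hτ
    have hTτ : 0 < T - τ := sub_pos.2 hτ
    rw [hσdef]
    simp only
    rw [mul_pow, mul_pow, Real.sq_sqrt (div_nonneg hTτ.le hν.le)]
    field_simp
  have hii' : ∀ t ∈ Ico t₁ T, IntervalIntegrable (fun τ => σ τ ^ 2 / (T - τ)) volume t₁ t := by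
    intro t ht
    have h := ((hii t ht).const_mul (κ ^ 2)).div_const ν
    refine h.congr fun τ hτ => ?_
    rw [uIoc_of_le ht.1] at hτ
    rw [hστ τ (hτ.2.trans_lt ht.2)]
  have hS : ∀ t ∈ Ico t₁ T, ∫ x, ⟪curl (u t) x, fderiv ℝ (u t) x (curl (u t) x)⟫ ≤
      σ t * Real.sqrt (ν / (T - t)) * Real.sqrt (∫ x, ‖curl (u t) x‖ ^ 2) *
        Real.sqrt (∫ x, frobeniusNormSq (fderiv ℝ (curl (u t)) x)) := by
    intro t ht
    have hTt : 0 < T - t := sub_pos.2 ht.2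
    have hσt : σ t * Real.sqrt (ν / (T - t)) = κ * m t := by
      rw [hσdef]
      simp only
      rw [mul_assoc, ← Real.sqrt_mul (div_nonneg hTt.le hν.le),
        show (T - t) / ν * (ν / (T - t)) = 1 by field_simp, Real.sqrt_one, mul_one]
    rw [hσt]
    exact (le_abs_self _).trans (hdep t ht)
  have hmean : ∀ t ∈ Ico t₁ T, ∫ τ in t₁..t, σ τ ^ 2 / (T - τ) ≤
      (κ ^ 2 * A) * Real.log ((T - t₁) / (T - t)) + κ ^ 2 * B := by
    intro t ht
    have heq : ∫ τ in t₁..t, σ τ ^ 2 / (T - τ) = ∫ τ in t₁..t, κ ^ 2 / ν * m τ ^ 2 := by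
      refine intervalIntegral.integral_congr fun τ hτ => ?_
      rw [uIcc_of_le ht.1] at hτ
      rw [hστ τ (hτ.2.trans_lt ht.2)]
      ring
    rw [heq, intervalIntegral.integral_const_mul]
    have h := hint t ht
    have hk : 0 ≤ κ ^ 2 / ν := by positivity
    calc κ ^ 2 / ν * ∫ τ in t₁..t, m τ ^ 2 ≤ κ ^ 2 / ν * (ν * (A * Real.log ((T - t₁) / (T - t)) + B)) :=
          mul_le_mul_of_nonneg_left h hk
      _ = (κ ^ 2 * A) * Real.log ((T - t₁) / (T - t)) + κ ^ 2 * B := by field_simp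
  have hρ : Real.sqrt (κ ^ 2 * A) ^ 2 < 1 := by
    by_cases h0 : 0 ≤ κ ^ 2 * A
    · rw [Real.sq_sqrt h0]; exact hA
    · rw [Real.sqrt_eq_zero'.2 (le_of_lt (not_le.1 h0))]; norm_num
  have hmean' : ∀ t ∈ Ico t₁ T, ∫ τ in t₁..t, σ τ ^ 2 / (T - τ) ≤
      Real.sqrt (κ ^ 2 * A) ^ 2 * Real.log ((T - t₁) / (T - t)) + κ ^ 2 * B := by
    intro t ht
    have hTt : 0 < T - t := sub_pos.2 ht.2
    have hlog : 0 ≤ Real.log ((T - t₁) / (T - t)) :=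
      Real.log_nonneg ((one_le_div hTt).2 (by linarith [ht.1]))
    refine (hmean t ht).trans (add_le_add (mul_le_mul_of_nonneg_right ?_ hlog) le_rfl)
    by_cases h0 : 0 ≤ κ ^ 2 * A
    · rw [Real.sq_sqrt h0]
    · rw [Real.sqrt_eq_zero'.2 (le_of_lt (not_le.1 h0))]; simp only [ne_eq, OfNat.ofNat_ne_zero,
        not_false_eq_true, zero_pow]; exact le_of_lt (not_le.1 h0)
  exact hasSmoothExtensionPast_of_logMean_stretching hν hT hρ ht₁ hsol hLH hdec hii' hS hmean'

/-- **The split constant along a flow, in any Galilean gauge.** For a classical Leray–Hopf rapidly-decaying-datum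
solution on `[0,T)`, every `t ∈ [0,T)`, every constant vector `c` and every `M` with `‖u(t,x) − c‖ ≤ M` for all
`x`: `|∫⟪ω(t), Du(t) ω(t)⟫| ≤ ((9+2√15)/42)·M·‖ω(t)‖₂·‖∇ω(t)‖₂` (the slice is admissible by the Tao cover;
`StrainCube.abs_integral_stretching_le_lambSplit_galilean`). [folklore] -/
theorem lambSplit_galilean_along_flow {ν T : ℝ} (hν : 0 < ν) (hT : 0 < T)
    {u : ℝ → EuclideanSpace ℝ (Fin 3) → EuclideanSpace ℝ (Fin 3)}
    {p : ℝ → EuclideanSpace ℝ (Fin 3) → ℝ}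
    (hsol : IsClassicalNSSolutionOn (Ico 0 T) ν 0 u p) (hLH : IsLerayHopfOn T ν 0 (u 0) u)
    (hdec : HasRapidSpatialDecay (u 0)) :
    ∀ t ∈ Ico 0 T, ∀ (c : EuclideanSpace ℝ (Fin 3)) (M : ℝ), (∀ x, ‖u t x - c‖ ≤ M) →
      |∫ x, ⟪curl (u t) x, fderiv ℝ (u t) x (curl (u t) x)⟫| ≤
        (9 + 2 * Real.sqrt 15) / 42 * M * Real.sqrt (∫ x, ‖curl (u t) x‖ ^ 2) *
          Real.sqrt (∫ x, frobeniusNormSq (fderiv ℝ (curl (u t)) x)) := by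
  intro t ht c M hM
  have ht' : (t + T) / 2 ∈ Ioo 0 T := ⟨by linarith [ht.1], by linarith [ht.2]⟩
  obtain ⟨q, hsolt, hut, -, -⟩ := stub_taoCover hν hT hsol hLH hdec ht'
  have htI : t ∈ Icc 0 ((t + T) / 2) := ⟨ht.1, by linarith [ht.2]⟩
  obtain ⟨C₀, hC₀⟩ := hut 0
  obtain ⟨C₁, hC₁⟩ := hut 1
  obtain ⟨C₂, hC₂⟩ := hut 2
  obtain ⟨B₁, -, hB₁⟩ := exists_forall_norm_fderiv_le_of_hasBoundedSobolevNormsOn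
    (fun s hs => (hsolt.contDiff_velocity hs).of_le (by norm_cast)) hut
  have h0 : ∫⁻ x, ‖iteratedFDeriv ℝ 0 (u t) x‖ₑ ^ 2 < ⊤ := (hC₀ t htI).trans_lt ENNReal.coe_lt_top
  have h1 : ∫⁻ x, ‖iteratedFDeriv ℝ 1 (u t) x‖ₑ ^ 2 < ⊤ := (hC₁ t htI).trans_lt ENNReal.coe_lt_top
  have h2 : ∫⁻ x, ‖iteratedFDeriv ℝ 2 (u t) x‖ₑ ^ 2 < ⊤ := (hC₂ t htI).trans_lt ENNReal.coe_lt_top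
  exact StrainCube.abs_integral_stretching_le_lambSplit_galilean (hsol.contDiff_velocity ht) (hsol.divFree t ht)
    c hM (hB₁ t htI) h0 h1 h2

/-- The threshold of the gauged log-amplitude rung in closed form: `((9+2√15)/42)²·A < 1 ↔ A < 564 − 144√15`
(`(18 − 4√15)² = 564 − 144√15 = 6.2903…`; was `81(7−4√3) = 5.8155…` at `κ = (2+√3)/9`). [folklore] -/
theorem lambSplit_amplitude_threshold (A : ℝ) :
    ((9 + 2 * Real.sqrt 15) / 42) ^ 2 * A < 1 ↔ A < 564 - 144 * Real.sqrt 15 := by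
  have h15 : Real.sqrt 15 ^ 2 = 15 := Real.sq_sqrt (by norm_num)
  have hpos : 0 < (9 + 2 * Real.sqrt 15) / 42 := by positivity
  have hinv : ((9 + 2 * Real.sqrt 15) / 42) ^ 2 * (564 - 144 * Real.sqrt 15) = 1 := by
    nlinarith [h15]
  constructor
  · intro h
    by_contra hc
    push Not at hc
    have := mul_le_mul_of_nonneg_left hc (sq_nonneg ((9 + 2 * Real.sqrt 15) / 42))
    linarith
  · intro h
    have := mul_lt_mul_of_pos_left h (pow_pos hpos 2)
    linarith

/-- **THE GAUGED LOG-AMPLITUDE RUNG at the split constant.** A classical Leray–Hopf rapidly-decaying-datum solution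
on `[0,T)` which, from some onset `t₁`, admits a gauge `c : ℝ → ℝ³` and an amplitude `m` with
`‖u(t,x) − c(t)‖ ≤ m(t)` (`t ∈ [t₁,T)`), `m²` locally interval integrable, and
`∫_{t₁}^t m² ≤ ν(A log((T−t₁)/(T−t)) + B)` with `((9+2√15)/42)²·A < 1` (i.e. `A < 564 − 144√15 ≈ 6.29`), extends
smoothly past `T`. [folklore] -/
theorem hasSmoothExtensionPast_of_logIntegral_gaugedAmplitude_lambSplit {ν T t₁ A B : ℝ} (hν : 0 < ν)
    (hT : 0 < T) (hA : ((9 + 2 * Real.sqrt 15) / 42) ^ 2 * A < 1) (ht₁ : t₁ ∈ Ico 0 T)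
    {u : ℝ → EuclideanSpace ℝ (Fin 3) → EuclideanSpace ℝ (Fin 3)}
    {p : ℝ → EuclideanSpace ℝ (Fin 3) → ℝ}
    (hsol : IsClassicalNSSolutionOn (Ico 0 T) ν 0 u p) (hLH : IsLerayHopfOn T ν 0 (u 0) u)
    (hdec : HasRapidSpatialDecay (u 0))
    {c : ℝ → EuclideanSpace ℝ (Fin 3)} {m : ℝ → ℝ}
    (hamp : ∀ t ∈ Ico t₁ T, ∀ x, ‖u t x - c t‖ ≤ m t)
    (hii : ∀ t ∈ Ico t₁ T, IntervalIntegrable (fun τ => m τ ^ 2) volume t₁ t)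
    (hint : ∀ t ∈ Ico t₁ T, ∫ τ in t₁..t, m τ ^ 2 ≤ ν * (A * Real.log ((T - t₁) / (T - t)) + B)) :
    HasSmoothExtensionPast ν 0 u T := by
  refine hasSmoothExtensionPast_of_logIntegral_amplitude_of_depletion hν hT hA ht₁ hsol hLH hdec hii
    (fun t ht => ?_) hint
  exact lambSplit_galilean_along_flow hν hT hsol hLH hdec t ⟨ht₁.1.trans ht.1, ht.2⟩ (c t) (m t) (hamp t ht)

end Summit.NavierStokesRegularity.NavierStokesRegularity.Theorems.DepletionLadder

end
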